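import Literature.Analysis.FluidPDE.GaussianVortexPlanarProofs
import Literature.Analysis.FluidPDE.BiotSavart2DSymmetry
import Mathlib.Analysis.Calculus.LineDeriv.IntegrationByParts
import Mathlib.Analysis.Calculus.Deriv.Inv
import Mathlib.MeasureTheory.Integral.DominatedConvergence
import Mathlib.MeasureTheory.Integral.Prod
import HarnessLib

/-!
# The planar Biot–Savart kernel is weakly divergence-free: `∫ ⟪K_{2D}(x − y), ∇h(x)⟫ dx = 0`

Analysis/FluidPDE file (all results proved, no definitions, no named facts). For the kernel
`K_{2D}(z) = z^⊥/(2π|z|²)` of the planar Biot–Savart law (`biotSavartKernel2D`,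
Gallay–Wayne 2006, (1.3); Gallay–Maekawa 2016, (4.2)) and every `h ∈ C¹_c(ℝ²)`:

* `integral_inner_regKernel_gradient_eq_zero` — for the smooth regularisation
  `K_ε(z) = z^⊥/(2π(|z|² + ε²))`, which is EXACTLY divergence-free
  (`fderiv_regKernel_fst_add_snd`: `∂₀(K_ε)₀ + ∂₁(K_ε)₁ = 0`, as for every field `z^⊥ g(|z|²)`),
  `∫ ⟪K_ε, ∇h⟫ = −∫ (div K_ε) h = 0` by one integration by parts per coordinate;
* `integral_inner_biotSavartKernel2D_gradient_eq_zero` — **`∫ ⟪K_{2D}(x), ∇h(x)⟫ dx = 0`**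
  (`ε → 0` by dominated convergence, `|K_ε| ≤ |K_{2D}| ∈ L¹_loc`), and its translates
  `∫ ⟪K_{2D}(x − y), ∇h(x)⟫ dx = 0` (`integral_inner_biotSavartKernel2D_sub_gradient_eq_zero`);
* `integral_inner_biotSavart2D_gradient_eq_zero` — **the Biot–Savart velocity `v = K_{2D} ∗ f` is
  weakly divergence-free**: `∫ ⟪v(x), ∇h(x)⟫ dx = 0` whenever the Biot–Savart integrals of `f`
  converge absolutely with a bound uniform in `x` (Fubini). This is the identity `div v = 0`
  behind the weak form of the vorticity equation (4.2) (`IsWeakAsymBurgersVortex`) and behind the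
  vanishing mean `∫ (v·∇)ω = 0` of its nonlinear term.

## References

* Th. Gallay, C. E. Wayne, J. Math. Fluid Mech. 9 (2007), (1.3) (`div v = 0` for
  `v = K_{2D} ∗ ω`). [GallayWayne2006]
* Th. Gallay, Y. Maekawa, arXiv:1610.08384, (4.2). [GallayMaekawa2016]
-/

open MeasureTheory Filter Set Metric Function
open scoped Real RealInnerProductSpace Topology InnerProductSpace

noncomputable section

namespace Literature.Analysis.FluidPDE

/-! ### The regularised kernel `K_ε(z) = z^⊥/(2π(|z|² + ε²))` -/

section RegKernel

variable {ε : ℝ} (hε : 0 < ε)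
include hε

/-- `|z|² + ε² > 0`. [folklore] -/
theorem normSq_add_sq_pos (z : EuclideanSpace ℝ (Fin 2)) : 0 < ‖z‖ ^ 2 + ε ^ 2 := by positivity

omit hε in
/-- The derivative of `s(z) = |z|² + ε²` is `2⟪z, ·⟫`. [folklore] -/
theorem hasFDerivAt_normSq_add_sq (z : EuclideanSpace ℝ (Fin 2)) :
    HasFDerivAt (fun w : EuclideanSpace ℝ (Fin 2) => ‖w‖ ^ 2 + ε ^ 2) ((2 : ℝ) • innerSL ℝ z) z := by
  have h0 := ((hasStrictFDerivAt_norm_sq z).hasFDerivAt).add_const (ε ^ 2)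
  refine h0.congr_fderiv ?_
  ext v
  simp [two_smul]

/-- The derivative of the radial factor `c(z) = (2π(|z|² + ε²))⁻¹`:
`Dc(z)[v] = −2c(z)⟪z, v⟫/(|z|² + ε²)`, written as `κ(z)⟪z, v⟫`. [folklore] -/
theorem hasFDerivAt_regFactor (z : EuclideanSpace ℝ (Fin 2)) :
    HasFDerivAt (fun w : EuclideanSpace ℝ (Fin 2) => (2 * Real.pi * (‖w‖ ^ 2 + ε ^ 2))⁻¹)
      ((-((2 * Real.pi * (‖z‖ ^ 2 + ε ^ 2)) ^ 2)⁻¹ * (2 * Real.pi) * 2) • innerSL ℝ z) z := by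
  have hs := (hasFDerivAt_normSq_add_sq (ε := ε) z).const_mul (2 * Real.pi)
  have hne : 2 * Real.pi * (‖z‖ ^ 2 + ε ^ 2) ≠ 0 := by
    have := normSq_add_sq_pos hε z; positivity
  have h := (hasDerivAt_inv hne).comp_hasFDerivAt z hs
  refine h.congr_fderiv ?_
  ext v
  simp only [FunLike.coe_smul, Pi.smul_apply, smul_eq_mul, innerSL_apply_apply]
  ring

/-- The radial factor is `C¹`. [folklore] -/
theorem contDiff_regFactor :
    ContDiff ℝ 1 fun w : EuclideanSpace ℝ (Fin 2) => (2 * Real.pi * (‖w‖ ^ 2 + ε ^ 2))⁻¹ :=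
  (contDiff_const.mul ((contDiff_norm_sq ℝ).add contDiff_const)).inv fun w => by
    have := normSq_add_sq_pos hε w; positivity

omit hε in
/-- The two components of `K_ε`, `(K_ε)₀ = −c z₁`, `(K_ε)₁ = c z₀`. [folklore] -/
theorem regKernel_apply (z : EuclideanSpace ℝ (Fin 2)) :
    ((2 * Real.pi * (‖z‖ ^ 2 + ε ^ 2))⁻¹ • perp z) 0 = -((2 * Real.pi * (‖z‖ ^ 2 + ε ^ 2))⁻¹ * z 1) ∧
      ((2 * Real.pi * (‖z‖ ^ 2 + ε ^ 2))⁻¹ • perp z) 1 = (2 * Real.pi * (‖z‖ ^ 2 + ε ^ 2))⁻¹ * z 0 := by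
  constructor <;> simp [mul_comm]

/-- `∂₀(K_ε)₀ = 2c z₀ z₁ · (2π)/(2π(|z|²+ε²))²`-type formula: the derivative of `−c z₁` along `e₀`.
[folklore] -/
theorem fderiv_regKernel_fst (z : EuclideanSpace ℝ (Fin 2)) :
    fderiv ℝ (fun w : EuclideanSpace ℝ (Fin 2) => -((2 * Real.pi * (‖w‖ ^ 2 + ε ^ 2))⁻¹ * w 1)) z
        (EuclideanSpace.single 0 1) =
      -((-((2 * Real.pi * (‖z‖ ^ 2 + ε ^ 2)) ^ 2)⁻¹ * (2 * Real.pi) * 2) * z 0 * z 1) := by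
  have hc := hasFDerivAt_regFactor hε z
  have h1 : HasFDerivAt (fun w : EuclideanSpace ℝ (Fin 2) => w 1)
      (EuclideanSpace.proj 1 : EuclideanSpace ℝ (Fin 2) →L[ℝ] ℝ) z :=
    (EuclideanSpace.proj (1 : Fin 2) : EuclideanSpace ℝ (Fin 2) →L[ℝ] ℝ).hasFDerivAt
  rw [((hc.fun_mul h1).fun_neg).fderiv]
  simp [EuclideanSpace.inner_single_right]
  ring

/-- The derivative of `(K_ε)₁ = c z₀` along `e₁`. [folklore] -/
theorem fderiv_regKernel_snd (z : EuclideanSpace ℝ (Fin 2)) :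
    fderiv ℝ (fun w : EuclideanSpace ℝ (Fin 2) => (2 * Real.pi * (‖w‖ ^ 2 + ε ^ 2))⁻¹ * w 0) z
        (EuclideanSpace.single 1 1) =
      -((2 * Real.pi * (‖z‖ ^ 2 + ε ^ 2)) ^ 2)⁻¹ * (2 * Real.pi) * 2 * z 1 * z 0 := by
  have hc := hasFDerivAt_regFactor hε z
  have h0 : HasFDerivAt (fun w : EuclideanSpace ℝ (Fin 2) => w 0)
      (EuclideanSpace.proj 0 : EuclideanSpace ℝ (Fin 2) →L[ℝ] ℝ) z :=
    (EuclideanSpace.proj (0 : Fin 2) : EuclideanSpace ℝ (Fin 2) →L[ℝ] ℝ).hasFDerivAt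
  rw [(hc.fun_mul h0).fderiv]
  simp [EuclideanSpace.inner_single_right]
  ring

/-- **`K_ε` is divergence-free**: `∂₀(K_ε)₀ + ∂₁(K_ε)₁ = 0` pointwise. [folklore] -/
theorem fderiv_regKernel_fst_add_snd (z : EuclideanSpace ℝ (Fin 2)) :
    fderiv ℝ (fun w : EuclideanSpace ℝ (Fin 2) => -((2 * Real.pi * (‖w‖ ^ 2 + ε ^ 2))⁻¹ * w 1)) z
        (EuclideanSpace.single 0 1) +
      fderiv ℝ (fun w : EuclideanSpace ℝ (Fin 2) => (2 * Real.pi * (‖w‖ ^ 2 + ε ^ 2))⁻¹ * w 0) z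
        (EuclideanSpace.single 1 1) = 0 := by
  rw [fderiv_regKernel_fst hε, fderiv_regKernel_snd hε]
  ring

/-- The components of `K_ε` are `C¹`. [folklore] -/
theorem contDiff_regKernel_fst :
    ContDiff ℝ 1 fun w : EuclideanSpace ℝ (Fin 2) => -((2 * Real.pi * (‖w‖ ^ 2 + ε ^ 2))⁻¹ * w 1) :=
  ((contDiff_regFactor hε).mul
    (EuclideanSpace.proj (1 : Fin 2) : EuclideanSpace ℝ (Fin 2) →L[ℝ] ℝ).contDiff).neg

/-- The components of `K_ε` are `C¹`. [folklore] -/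
theorem contDiff_regKernel_snd :
    ContDiff ℝ 1 fun w : EuclideanSpace ℝ (Fin 2) => (2 * Real.pi * (‖w‖ ^ 2 + ε ^ 2))⁻¹ * w 0 :=
  (contDiff_regFactor hε).mul
    (EuclideanSpace.proj (0 : Fin 2) : EuclideanSpace ℝ (Fin 2) →L[ℝ] ℝ).contDiff

/-- `|K_ε(z)| ≤ |K_{2D}(z)|`. [folklore] -/
theorem norm_regKernel_le (z : EuclideanSpace ℝ (Fin 2)) :
    ‖(2 * Real.pi * (‖z‖ ^ 2 + ε ^ 2))⁻¹ • perp z‖ ≤ ‖biotSavartKernel2D z‖ := by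
  rw [norm_smul, norm_perp, norm_biotSavartKernel2D, norm_inv, Real.norm_of_nonneg (by positivity)]
  rcases eq_or_ne z 0 with rfl | hz
  · simp
  · have hn : 0 < ‖z‖ := norm_pos_iff.2 hz
    rw [mul_inv, mul_assoc]
    refine mul_le_mul_of_nonneg_left ?_ (by positivity)
    rw [inv_mul_le_iff₀ (normSq_add_sq_pos hε z), ← div_eq_mul_inv, le_div_iff₀ hn]
    nlinarith [sq_nonneg ε]

end RegKernel

/-! ### `∫ ⟪K_ε, ∇h⟫ = 0` by integration by parts -/

section IBP

variable {h : EuclideanSpace ℝ (Fin 2) → ℝ} (hh : ContDiff ℝ 1 h) (hhc : HasCompactSupport h)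
  {ε : ℝ} (hε : 0 < ε)
include hh hhc hε

/-- **`∫ ⟪K_ε(x), ∇h(x)⟫ dx = 0`** for `h ∈ C¹_c(ℝ²)`: `⟪K_ε, ∇h⟫ = (K_ε)₀∂₀h + (K_ε)₁∂₁h`, one
integration by parts per coordinate, and `div K_ε = 0`. [folklore] -/
theorem integral_inner_regKernel_gradient_eq_zero :
    ∫ x : EuclideanSpace ℝ (Fin 2), ⟪(2 * Real.pi * (‖x‖ ^ 2 + ε ^ 2))⁻¹ • perp x, gradient h x⟫ = 0 := by
  set k0 : EuclideanSpace ℝ (Fin 2) → ℝ := fun w => -((2 * Real.pi * (‖w‖ ^ 2 + ε ^ 2))⁻¹ * w 1)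
    with hk0
  set k1 : EuclideanSpace ℝ (Fin 2) → ℝ := fun w => (2 * Real.pi * (‖w‖ ^ 2 + ε ^ 2))⁻¹ * w 0
    with hk1
  have hk0c : ContDiff ℝ 1 k0 := contDiff_regKernel_fst hε
  have hk1c : ContDiff ℝ 1 k1 := contDiff_regKernel_snd hε
  have hhd : Differentiable ℝ h := hh.differentiable one_ne_zero
  have hh1c : ∀ i : Fin 2, Continuous fun x => fderiv ℝ h x (EuclideanSpace.single i 1) := fun i =>
    (hh.continuous_fderiv one_ne_zero).clm_apply continuous_const
  have hh1s : ∀ i : Fin 2, HasCompactSupport fun x => fderiv ℝ h x (EuclideanSpace.single i 1) :=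
    fun i => hhc.fderiv_apply (𝕜 := ℝ) _
  -- the integrand in coordinates
  have hintegrand : ∀ x : EuclideanSpace ℝ (Fin 2),
      ⟪(2 * Real.pi * (‖x‖ ^ 2 + ε ^ 2))⁻¹ • perp x, gradient h x⟫ =
        k0 x * fderiv ℝ h x (EuclideanSpace.single 0 1) + k1 x * fderiv ℝ h x (EuclideanSpace.single 1 1) := by
    intro x
    rw [real_inner_comm, gradient, InnerProductSpace.toDual_symm_apply]
    set u := (2 * Real.pi * (‖x‖ ^ 2 + ε ^ 2))⁻¹ • perp x with hu
    have e : u = u 0 • EuclideanSpace.single 0 (1 : ℝ) + u 1 • EuclideanSpace.single 1 (1 : ℝ) := by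
      ext j; fin_cases j <;> simp
    conv_lhs => rw [e]
    rw [map_add, map_smul, map_smul, smul_eq_mul, smul_eq_mul]
    obtain ⟨h0, h1⟩ := regKernel_apply (ε := ε) x
    rw [hu, h0, h1]
  simp_rw [hintegrand]
  -- integration by parts in each coordinate
  have ibp : ∀ (i : Fin 2) {k : EuclideanSpace ℝ (Fin 2) → ℝ}, ContDiff ℝ 1 k →
      ∫ x, k x * fderiv ℝ h x (EuclideanSpace.single i 1) =
        -∫ x, fderiv ℝ k x (EuclideanSpace.single i 1) * h x := by
    intro i k hk
    have hkc : Continuous k := hk.continuous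
    have hk1 : Continuous fun x => fderiv ℝ k x (EuclideanSpace.single i 1) :=
      (hk.continuous_fderiv one_ne_zero).clm_apply continuous_const
    refine integral_mul_fderiv_eq_neg_fderiv_mul_of_integrable ?_ ?_ ?_
      (fun x _ => (hk.differentiable one_ne_zero) x) (fun x _ => hhd x)
    · exact (hk1.mul hh.continuous).integrable_of_hasCompactSupport hhc.mul_left
    · exact (hkc.mul (hh1c i)).integrable_of_hasCompactSupport (hh1s i).mul_left
    · exact (hkc.mul hh.continuous).integrable_of_hasCompactSupport hhc.mul_left
  have i0 : Integrable fun x => k0 x * fderiv ℝ h x (EuclideanSpace.single 0 1) :=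
    (hk0c.continuous.mul (hh1c 0)).integrable_of_hasCompactSupport (hh1s 0).mul_left
  have i1 : Integrable fun x => k1 x * fderiv ℝ h x (EuclideanSpace.single 1 1) :=
    (hk1c.continuous.mul (hh1c 1)).integrable_of_hasCompactSupport (hh1s 1).mul_left
  have j0 : Integrable fun x => fderiv ℝ k0 x (EuclideanSpace.single 0 1) * h x :=
    (((hk0c.continuous_fderiv one_ne_zero).clm_apply continuous_const).mul hh.continuous)
      |>.integrable_of_hasCompactSupport hhc.mul_left
  have j1 : Integrable fun x => fderiv ℝ k1 x (EuclideanSpace.single 1 1) * h x :=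
    (((hk1c.continuous_fderiv one_ne_zero).clm_apply continuous_const).mul hh.continuous)
      |>.integrable_of_hasCompactSupport hhc.mul_left
  rw [integral_add i0 i1, ibp 0 hk0c, ibp 1 hk1c, ← neg_add, ← integral_add j0 j1]
  have hzero : (fun x => fderiv ℝ k0 x (EuclideanSpace.single 0 1) * h x +
      fderiv ℝ k1 x (EuclideanSpace.single 1 1) * h x) = fun _ => 0 := by
    funext x
    rw [← add_mul, hk0, hk1, fderiv_regKernel_fst_add_snd hε x, zero_mul]
  rw [hzero, integral_zero, neg_zero]

end IBP

/-! ### `∫ ⟪K_{2D}, ∇h⟫ = 0`: the limit `ε → 0` and translates -/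

section Limit

variable {h : EuclideanSpace ℝ (Fin 2) → ℝ} (hh : ContDiff ℝ 1 h) (hhc : HasCompactSupport h)
include hh hhc

/-- `x ↦ ‖K_{2D}(x)‖ ‖Dh(x)‖` is integrable (`Dh` bounded with compact support, `|K_{2D}| ∈ L¹_loc`).
[folklore] -/
theorem integrable_norm_biotSavartKernel2D_mul_norm_fderiv :
    Integrable fun x : EuclideanSpace ℝ (Fin 2) => ‖biotSavartKernel2D x‖ * ‖fderiv ℝ h x‖ := by
  obtain ⟨C, hC⟩ := (hh.continuous_fderiv one_ne_zero).bounded_above_of_compact_support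
    (hhc.fderiv (𝕜 := ℝ))
  have hC0 : 0 ≤ C := (norm_nonneg _).trans (hC 0)
  obtain ⟨R, hR⟩ := (hhc.fderiv (𝕜 := ℝ)).isCompact.isBounded.subset_ball 0
  have hzero : ∀ x, x ∉ ball (0 : EuclideanSpace ℝ (Fin 2)) R → fderiv ℝ h x = 0 := fun x hx =>
    image_eq_zero_of_notMem_tsupport fun h' => hx (hR h')
  have hmaj : Integrable fun x : EuclideanSpace ℝ (Fin 2) =>
      C * ((2 * Real.pi)⁻¹ * indicator (ball (0 : EuclideanSpace ℝ (Fin 2)) R) (fun z => ‖z‖⁻¹) x) :=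
    (((integrableOn_inv_norm_ball R).integrable_indicator measurableSet_ball).const_mul _).const_mul _
  refine hmaj.mono' ((measurable_biotSavartKernel2D.norm.mul
    (hh.continuous_fderiv one_ne_zero).norm.measurable).aestronglyMeasurable)
    (Eventually.of_forall fun x => ?_)
  rw [Real.norm_of_nonneg (by positivity), norm_biotSavartKernel2D]
  by_cases hx : x ∈ ball (0 : EuclideanSpace ℝ (Fin 2)) R
  · rw [indicator_of_mem hx]
    calc (2 * Real.pi)⁻¹ * ‖x‖⁻¹ * ‖fderiv ℝ h x‖ ≤ (2 * Real.pi)⁻¹ * ‖x‖⁻¹ * C :=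
          mul_le_mul_of_nonneg_left (hC x) (by positivity)
      _ = C * ((2 * Real.pi)⁻¹ * ‖x‖⁻¹) := by ring
  · rw [hzero x hx, norm_zero, mul_zero, indicator_of_notMem hx, mul_zero, mul_zero]

/-- **`∫ ⟪K_{2D}(x), ∇h(x)⟫ dx = 0`** for every `h ∈ C¹_c(ℝ²)`: the planar Biot–Savart kernel is
weakly divergence-free (from the regularised identity by dominated convergence as
`ε = 1/(k+1) → 0`, with `|⟪K_ε, ∇h⟫| ≤ |K_{2D}| ‖Dh‖ ∈ L¹`). [folklore] -/
theorem integral_inner_biotSavartKernel2D_gradient_eq_zero :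
    ∫ x : EuclideanSpace ℝ (Fin 2), ⟪biotSavartKernel2D x, gradient h x⟫ = 0 := by
  have hεk : ∀ k : ℕ, (0 : ℝ) < ((k : ℝ) + 1)⁻¹ := fun k => by positivity
  have hgc : Continuous (gradient h) :=
    (InnerProductSpace.toDual ℝ (EuclideanSpace ℝ (Fin 2))).symm.continuous.comp
      (hh.continuous_fderiv one_ne_zero)
  have hng : ∀ x, ‖gradient h x‖ = ‖fderiv ℝ h x‖ := fun x => by
    rw [gradient, LinearIsometryEquiv.norm_map]
  set F : ℕ → EuclideanSpace ℝ (Fin 2) → ℝ := fun k x =>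
    ⟪(2 * Real.pi * (‖x‖ ^ 2 + ((k : ℝ) + 1)⁻¹ ^ 2))⁻¹ • perp x, gradient h x⟫ with hF
  have hlim : Tendsto (fun k => ∫ x, F k x) atTop
      (𝓝 (∫ x : EuclideanSpace ℝ (Fin 2), ⟪biotSavartKernel2D x, gradient h x⟫)) := by
    refine tendsto_integral_of_dominated_convergence (fun x => ‖biotSavartKernel2D x‖ * ‖fderiv ℝ h x‖)
      (fun k => ?_) (integrable_norm_biotSavartKernel2D_mul_norm_fderiv hh hhc) (fun k => ?_) ?_
    · -- measurability: the integrand is continuous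
      have hc : Continuous fun x : EuclideanSpace ℝ (Fin 2) =>
          (2 * Real.pi * (‖x‖ ^ 2 + ((k : ℝ) + 1)⁻¹ ^ 2))⁻¹ • perp x :=
        ((contDiff_regFactor (hεk k)).continuous).smul continuous_perp
      exact (hc.inner hgc).aestronglyMeasurable
    · refine Eventually.of_forall fun x => ?_
      rw [Real.norm_eq_abs, ← hng]
      exact (abs_real_inner_le_norm _ _).trans
        (mul_le_mul_of_nonneg_right (norm_regKernel_le (hεk k) x) (norm_nonneg _))
    · refine Eventually.of_forall fun x => ?_
      refine Tendsto.inner ?_ tendsto_const_nhds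
      rcases eq_or_ne x 0 with rfl | hx
      · have hp : perp (0 : EuclideanSpace ℝ (Fin 2)) = 0 := by
          ext j; fin_cases j <;> simp
        simp only [hp, smul_zero, biotSavartKernel2D_zero]
        exact tendsto_const_nhds
      · have hxn : ‖x‖ ^ 2 ≠ 0 := by positivity
        have h1 : Tendsto (fun k : ℕ => ((k : ℝ) + 1)⁻¹) atTop (𝓝 0) := by
          simpa [one_div] using tendsto_one_div_add_atTop_nhds_zero_nat (𝕜 := ℝ)
        have h2 : Tendsto (fun k : ℕ => (2 * Real.pi * (‖x‖ ^ 2 + ((k : ℝ) + 1)⁻¹ ^ 2))⁻¹) atTop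
            (𝓝 ((2 * Real.pi * ‖x‖ ^ 2)⁻¹)) := by
          have := ((h1.pow 2).const_add (‖x‖ ^ 2)).const_mul (2 * Real.pi)
          rw [zero_pow two_ne_zero, add_zero] at this
          exact this.inv₀ (by positivity)
        simp only [biotSavartKernel2D]
        exact h2.smul_const _
  have hzero : ∀ k, ∫ x, F k x = 0 := fun k =>
    integral_inner_regKernel_gradient_eq_zero hh hhc (hεk k)
  simp_rw [hzero] at hlim
  exact tendsto_nhds_unique hlim tendsto_const_nhds

/-- **`∫ ⟪K_{2D}(x − y), ∇h(x)⟫ dx = 0`** for every `y` and `h ∈ C¹_c(ℝ²)` (translate `h`).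
[folklore] -/
theorem integral_inner_biotSavartKernel2D_sub_gradient_eq_zero (y : EuclideanSpace ℝ (Fin 2)) :
    ∫ x : EuclideanSpace ℝ (Fin 2), ⟪biotSavartKernel2D (x - y), gradient h x⟫ = 0 := by
  have hhy : ContDiff ℝ 1 fun z : EuclideanSpace ℝ (Fin 2) => h (z + y) :=
    hh.comp (contDiff_id.add contDiff_const)
  have hhyc : HasCompactSupport fun z : EuclideanSpace ℝ (Fin 2) => h (z + y) :=
    hhc.comp_homeomorph (Homeomorph.addRight y)
  have key := integral_inner_biotSavartKernel2D_gradient_eq_zero hhy hhyc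
  have hgrad : ∀ z : EuclideanSpace ℝ (Fin 2), gradient (fun w => h (w + y)) z = gradient h (z + y) := by
    intro z
    rw [gradient, gradient, fderiv_comp_add_right]
  have htrans : (fun x : EuclideanSpace ℝ (Fin 2) => ⟪biotSavartKernel2D (x - y), gradient h x⟫) =
      fun x => (fun z => ⟪biotSavartKernel2D z, gradient (fun w => h (w + y)) z⟫) (x - y) := by
    funext x
    simp only [hgrad, sub_add_cancel]
  rw [htrans, integral_sub_right_eq_self (fun z => ⟪biotSavartKernel2D z,
    gradient (fun w => h (w + y)) z⟫) y]
  exact key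

end Limit

/-! ### The Biot–Savart velocity is weakly divergence-free -/

/-- **`v = K_{2D} ∗ f` is weakly divergence-free**: `∫ ⟪(K_{2D} ∗ f)(x), ∇h(x)⟫ dx = 0` for every
`h ∈ C¹_c(ℝ²)`, provided the Biot–Savart integrals `∫ f(y) K_{2D}(x − y) dy` converge absolutely
for every `x` with a bound `∫ |f(y)| |K_{2D}(x − y)| dy ≤ M` uniform in `x` (as for bounded
integrable `f`, or `f = ρ_λ u` with `(u, ∇u) ∈ H¹(μ_λ)`). Proof: `⟪∫ f K(x−·), ∇h(x)⟫ =
∫ f(y)⟪K(x−y), ∇h(x)⟫ dy`, Fubini, and `∫ ⟪K(x−y), ∇h(x)⟫ dx = 0`. [folklore] -/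
theorem integral_inner_biotSavart2D_gradient_eq_zero {f : EuclideanSpace ℝ (Fin 2) → ℝ}
    (hf : Integrable f) (hK : ∀ x, Integrable fun y => f y • biotSavartKernel2D (x - y))
    {M : ℝ} (hM : ∀ x, ∫ y, ‖f y • biotSavartKernel2D (x - y)‖ ≤ M)
    {h : EuclideanSpace ℝ (Fin 2) → ℝ} (hh : ContDiff ℝ 1 h) (hhc : HasCompactSupport h) :
    ∫ x : EuclideanSpace ℝ (Fin 2), ⟪biotSavart2D f x, gradient h x⟫ = 0 := by
  have hgc : Continuous (gradient h) :=
    (InnerProductSpace.toDual ℝ (EuclideanSpace ℝ (Fin 2))).symm.continuous.comp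
      (hh.continuous_fderiv one_ne_zero)
  have hng : ∀ x, ‖gradient h x‖ = ‖fderiv ℝ h x‖ := fun x => by
    rw [gradient, LinearIsometryEquiv.norm_map]
  -- Step 1: move the inner product inside the Biot–Savart integral
  have h1 : ∀ x, ⟪biotSavart2D f x, gradient h x⟫ =
      ∫ y, ⟪f y • biotSavartKernel2D (x - y), gradient h x⟫ := by
    intro x
    unfold biotSavart2D
    rw [real_inner_comm, ← innerSL_apply_apply (𝕜 := ℝ),
      ← ContinuousLinearMap.integral_comp_comm _ (hK x)]
    exact integral_congr_ae (Eventually.of_forall fun y => by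
      dsimp only
      rw [innerSL_apply_apply, real_inner_comm])
  simp_rw [h1]
  -- Step 2: Fubini
  have hGm : AEStronglyMeasurable
      (uncurry fun x y : EuclideanSpace ℝ (Fin 2) => ⟪f y • biotSavartKernel2D (x - y), gradient h x⟫)
      ((volume : Measure (EuclideanSpace ℝ (Fin 2))).prod volume) := by
    have hfm : AEStronglyMeasurable (fun p : EuclideanSpace ℝ (Fin 2) × EuclideanSpace ℝ (Fin 2) => f p.2)
        ((volume : Measure (EuclideanSpace ℝ (Fin 2))).prod volume) := hf.aestronglyMeasurable.comp_snd
    have hKm : AEStronglyMeasurable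
        (fun p : EuclideanSpace ℝ (Fin 2) × EuclideanSpace ℝ (Fin 2) => biotSavartKernel2D (p.1 - p.2))
        ((volume : Measure (EuclideanSpace ℝ (Fin 2))).prod volume) :=
      (measurable_biotSavartKernel2D.comp (measurable_fst.sub measurable_snd)).aestronglyMeasurable
    have hgm : AEStronglyMeasurable
        (fun p : EuclideanSpace ℝ (Fin 2) × EuclideanSpace ℝ (Fin 2) => gradient h p.1)
        ((volume : Measure (EuclideanSpace ℝ (Fin 2))).prod volume) :=
      (hgc.comp continuous_fst).aestronglyMeasurable
    exact (hfm.smul hKm).inner hgm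
  have hbd : Integrable fun x : EuclideanSpace ℝ (Fin 2) => M * ‖fderiv ℝ h x‖ :=
    (((hh.continuous_fderiv one_ne_zero).norm).integrable_of_hasCompactSupport
      (hhc.fderiv (𝕜 := ℝ)).norm).const_mul M
  have hrow : ∀ x, Integrable (fun y : EuclideanSpace ℝ (Fin 2) =>
      ⟪f y • biotSavartKernel2D (x - y), gradient h x⟫) volume := fun x =>
    (hK x).inner_const (gradient h x)
  have hrowbd : ∀ x, ∫ y, ‖⟪f y • biotSavartKernel2D (x - y), gradient h x⟫‖ ≤ M * ‖fderiv ℝ h x‖ := by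
    intro x
    calc ∫ y, ‖⟪f y • biotSavartKernel2D (x - y), gradient h x⟫‖
        ≤ ∫ y, ‖f y • biotSavartKernel2D (x - y)‖ * ‖fderiv ℝ h x‖ := by
          refine integral_mono (hrow x).norm ((hK x).norm.mul_const _) fun y => ?_
          dsimp only
          rw [Real.norm_eq_abs, ← hng]
          exact abs_real_inner_le_norm _ _
      _ = (∫ y, ‖f y • biotSavartKernel2D (x - y)‖) * ‖fderiv ℝ h x‖ := integral_mul_const _ _
      _ ≤ M * ‖fderiv ℝ h x‖ := mul_le_mul_of_nonneg_right (hM x) (norm_nonneg _)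
  have hGi : Integrable
      (uncurry fun x y : EuclideanSpace ℝ (Fin 2) => ⟪f y • biotSavartKernel2D (x - y), gradient h x⟫)
      ((volume : Measure (EuclideanSpace ℝ (Fin 2))).prod volume) := by
    rw [integrable_prod_iff hGm]
    refine ⟨Eventually.of_forall fun x => hrow x, ?_⟩
    refine hbd.mono' hGm.norm.integral_prod_right' (Eventually.of_forall fun x => ?_)
    rw [Real.norm_of_nonneg (integral_nonneg fun y => norm_nonneg _)]
    exact hrowbd x
  rw [integral_integral_swap hGi]
  -- Step 3: the inner integral vanishes for every `y`
  have h2 : ∀ y, ∫ x, ⟪f y • biotSavartKernel2D (x - y), gradient h x⟫ = 0 := by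
    intro y
    simp only [real_inner_smul_left]
    rw [integral_const_mul, integral_inner_biotSavartKernel2D_sub_gradient_eq_zero hh hhc y, mul_zero]
  simp_rw [h2]
  exact integral_zero _ _

end Literature.Analysis.FluidPDE
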